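import Summits.CriticalPhenomena.Ising3DConformalLimit.Theses.LeeYangGap
import Summits.CriticalPhenomena.Ising3DConformalLimit.Theorems.PerfectScreeningCoulombImpliesNontrivialBlockLaw
import Summits.CriticalPhenomena.Ising3DConformalLimit.Theorems.PerfectScreeningCoulombImpliesNontrivialLeeYangPackage

/-!
# Route LeeYangGap, support item stmt-CriticalPhenomena-4949 `NewmanFirstZeroBound` — proved

`NewmanFirstZeroBound`: at `β_c(3)`, if `θ > 0` is a zero of `θ ↦ ⟨cos(θ M_L)⟩_{β_c}` for the critical
block spin `M_L = Σ_{x ∈ box 3 L} σ_x`, then `12/θ⁴ ≤ 3⟨M_L²⟩² − ⟨M_L⁴⟩` (Newman, CMP 41 (1975), Thm 4 /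
Prop. 2: `−u₄(M_L) = 12 Σ_j t_j⁻⁴ ≥ 12 t₁⁻⁴` over the Lee–Yang zeros `±i t_j` of the block law).

Obtained as a by-product of line `SketchPub` of crux `PerfectScreening.CoulombImpliesNontrivial`
(stmt-CriticalPhenomena-13885): the critical block law is a finite symmetric Lee–Yang pmf
(`PerfectScreeningCoulombImpliesNontrivial.stub_blockLaw`, infinite volume at `β_c` via `m*(β_c) = 0` and
Newman's closure theorem) and Newman's lattice package for such pmfs
(`PerfectScreeningCoulombImpliesNontrivial.stub_leeYangPackage`, whose last conjunct is the first-zero bound,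
from the factorisation `Σ p_k cos(θk) = cos^m θ ∏ (1 − bᵢ sin² θ)`, the coefficient inequality
`2m + 12Σbᵢ² − 8Σbᵢ ≤ −u₄` and the elementary `12/sin⁴θ − 8/sin²θ ≥ 12/θ⁴`).
-/

noncomputable section

namespace Summit.CriticalPhenomena.Ising3DConformalLimit.LeeYangGapNewmanFirstZeroBound

open Literature.Probability.LatticeModels

/-- **Newman's first-zero bound for the critical block spin on `ℤ³`** (route LeeYangGap, item
stmt-CriticalPhenomena-4949): for every `L` and every zero `θ > 0` of `θ ↦ ⟨cos(θ M_L)⟩_{β_c}`,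
`12/θ⁴ ≤ 3⟨M_L²⟩²_{β_c} − ⟨M_L⁴⟩_{β_c}`. Proof: write `⟨f(M_L)⟩ = Σ_k p_k f(k)` for the Lee–Yang block pmf
`p` and apply the last conjunct of Newman's lattice package. -/
theorem newmanFirstZeroBound_proof :
    Summit.CriticalPhenomena.Ising3DConformalLimit.Theses.LeeYangGap.NewmanFirstZeroBound := by
  intro L θ hθ hzero
  obtain ⟨p, hp0, hsymm, hpar, hmass, hlaw, hLY⟩ :=
    PerfectScreeningCoulombImpliesNontrivial.stub_blockLaw L
  obtain ⟨m, n, b, -, -, -, -, -, -, -, hnewman⟩ :=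
    PerfectScreeningCoulombImpliesNontrivial.stub_leeYangPackage ((2 * L + 1) ^ 3) p hp0 hsymm hpar hmass hLY
  rw [hlaw (fun u => Real.cos (θ * u))] at hzero
  rw [hlaw (fun u => u ^ 2), hlaw (fun u => u ^ 4)]
  exact hnewman θ hθ hzero

end Summit.CriticalPhenomena.Ising3DConformalLimit.LeeYangGapNewmanFirstZeroBound

end
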